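/-
# The Wolff-packing model: exact lattice cancellation inside the zero-side class — part C (§§4–6)

(rh-split cell, seat rh-split-screw-bridge g13, 2026-08-27; kernel scratch for card `cards/SPLIT-screw-bridge.md` §18,
barrier candidate B16.)  Part C of the three-part carve of `HOME/rh-split-screw-bridge/g13/ScrewLatticeWolff.lean`
(sha16 14a22eecb442a4a4, 637 l): §§4–6 = source ll. 389–637 byte-identical, namespace re-opened (FQNs unchanged).
Nothing in this file is a claim about the truth of RH; no declaration mentions `ζ`.
-/
import Summits.RiemannHypothesis.RiemannHypothesis.Theorems.Splittings.ScrewLatticeWolffB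
import HarnessLib

/-!
# Part C — the model on the lattice: summation, the packing identity, floor/ceiling, and `LPSD(h)` (§§4–6)

CARVE NOTE (author rh-split-screw-bridge g13, lead RULING #161 (3)–(4), 2026-08-27): source ll. 389–637 of the frozen
`ScrewLatticeWolff.lean` 14a22eecb442a4a4 reproduced BYTE-IDENTICALLY between the `namespace` line below and the closing
`end`; preamble (`set_option`, `noncomputable section`, `open`s) copied from source ll. 65–70.  Contents: `modelPsi`, `modelPsi_lattice(_eq_tsum)`, `modelPsi_lattice_floor` / `_ceiling` / `_latticePos`, `summable_alpha_mul_negdef`, `modelPsi_lattice_negdef`, **`modelPsi_latticePSD`**.  Source l. 635 closes the namespace and l. 637 the section.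
-/

set_option linter.dupNamespace false

noncomputable section

open Complex Filter Topology Finset
open scoped ComplexConjugate

namespace Summit.RiemannHypothesis.RiemannHypothesis.Theorems.Splittings.ScrewLatticeWolff

/-! ## 4. The model on the lattice: summation and the packing identity -/

section Model

variable {ι : Type*} (m₁ m₂ α : ι → ℝ) (κ₁ κ₂ w : ι → ℂ) (h lam : ℝ)

/-- The model screw function of the configuration: `Ψ_Z(t) = Σ_i (T_{(i,1)}(t) + T_{(i,2)}(t))`. -/
def modelPsi (t : ℝ) : ℝ :=
  ∑' i, (quadTerm (m₁ i) (κ₁ i) t + quadTerm (m₂ i) (κ₂ i) t)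

/-- The model screw function is even. [folklore] -/
theorem modelPsi_neg (t : ℝ) : modelPsi m₁ m₂ κ₁ κ₂ (-t) = modelPsi m₁ m₂ κ₁ κ₂ t := by
  simp only [modelPsi, quadTerm_neg]

/-- The model screw function vanishes at `0`. [folklore] -/
theorem modelPsi_zero : modelPsi m₁ m₂ κ₁ κ₂ 0 = 0 := by
  simp [modelPsi, quadTerm_zero]

variable {m₁ m₂ α κ₁ κ₂ w h lam}

/-- Pairwise lattice formula, summed: `Ψ_Z(k h) = 2λ Σ_i α_i (2 - Re w_i^k - Re w_i^{-k})` (no (W) yet). -/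
theorem modelPsi_lattice_eq_tsum (hw₁ : ∀ i, Complex.exp (κ₁ i * h) = w i)
    (hw₂ : ∀ i, Complex.exp (κ₂ i * h) = conj (w i))
    (htune : ∀ i, (m₁ i : ℂ) / κ₁ i ^ 2 + (m₂ i : ℂ) / (conj (κ₂ i)) ^ 2 = -((lam * α i : ℝ) : ℂ))
    (k : ℕ) :
    modelPsi m₁ m₂ κ₁ κ₂ (k * h) = 2 * lam * ∑' i, α i * (2 - (w i ^ k).re - ((w i ^ k)⁻¹).re) := by
  rw [modelPsi, ← tsum_mul_left]
  refine tsum_congr fun i ↦ ?_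
  rw [pairTerm_lattice (hw₁ i) (hw₂ i) (htune i) k]
  ring

/-- Summability bookkeeping: `|α_i Re w_i^{-k}| ≤ α_i` when `|w_i| ≥ 1`. -/
theorem summable_alpha_mul_re_inv (hα : Summable α) (hα0 : ∀ i, 0 ≤ α i) (hw1 : ∀ i, 1 ≤ ‖w i‖)
    (k : ℕ) : Summable fun i ↦ α i * ((w i ^ k)⁻¹).re := by
  refine Summable.of_norm_bounded hα fun i ↦ ?_
  rw [Real.norm_eq_abs, abs_mul, abs_of_nonneg (hα0 i)]
  refine mul_le_of_le_one_right (hα0 i) ?_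
  refine (Complex.abs_re_le_norm _).trans ?_
  rw [norm_inv, norm_pow]
  exact inv_le_one_of_one_le₀ (one_le_pow₀ (hw1 i))

/-- `|∑ αᵢ Re (wᵢ^k)⁻¹| ≤ ∑ αᵢ` for `αᵢ ≥ 0` summable and `‖wᵢ‖ ≥ 1`. [folklore] -/
theorem tsum_alpha_mul_re_inv_abs_le (hα : Summable α) (hα0 : ∀ i, 0 ≤ α i) (hw1 : ∀ i, 1 ≤ ‖w i‖)
    (k : ℕ) : |∑' i, α i * ((w i ^ k)⁻¹).re| ≤ ∑' i, α i := by
  have hs := summable_alpha_mul_re_inv hα hα0 hw1 k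
  have hle : ∀ i, |α i * ((w i ^ k)⁻¹).re| ≤ α i := fun i ↦ by
    rw [abs_mul, abs_of_nonneg (hα0 i)]
    refine mul_le_of_le_one_right (hα0 i) ?_
    refine (Complex.abs_re_le_norm _).trans ?_
    rw [norm_inv, norm_pow]
    exact inv_le_one_of_one_le₀ (one_le_pow₀ (hw1 i))
  rw [abs_le]
  constructor
  · rw [← tsum_neg]
    exact Summable.tsum_le_tsum (fun i ↦ (abs_le.1 (hle i)).1) hα.neg hs
  · exact Summable.tsum_le_tsum (fun i ↦ (abs_le.1 (hle i)).2) hs hα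

/-- Summability bookkeeping: `|α_i Re w_i^{k}| ≤ α_i R^k` when `|w_i| ≤ R`. -/
theorem summable_alpha_mul_re_pow (hα : Summable α) (hα0 : ∀ i, 0 ≤ α i) {R : ℝ}
    (hwR : ∀ i, ‖w i‖ ≤ R) (k : ℕ) : Summable fun i ↦ α i * (w i ^ k).re := by
  refine Summable.of_norm_bounded (hα.mul_right (R ^ k)) fun i ↦ ?_
  rw [Real.norm_eq_abs, abs_mul, abs_of_nonneg (hα0 i)]
  refine mul_le_mul_of_nonneg_left ?_ (hα0 i)
  refine (Complex.abs_re_le_norm _).trans ?_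
  rw [norm_pow]
  exact pow_le_pow_left₀ (norm_nonneg _) (hwR i) k

/-- **THE MODEL ON THE LATTICE** under the Wolff identity (W): for `k ≥ 1`,
`Ψ_Z(k h) = 2λ (2 Σ_i α_i - Σ_i α_i Re w_i^{-k})`. -/
theorem modelPsi_lattice (hw₁ : ∀ i, Complex.exp (κ₁ i * h) = w i)
    (hw₂ : ∀ i, Complex.exp (κ₂ i * h) = conj (w i))
    (htune : ∀ i, (m₁ i : ℂ) / κ₁ i ^ 2 + (m₂ i : ℂ) / (conj (κ₂ i)) ^ 2 = -((lam * α i : ℝ) : ℂ))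
    (hα : Summable α) (hα0 : ∀ i, 0 ≤ α i) (hw1 : ∀ i, 1 ≤ ‖w i‖)
    (hW : ∀ k : ℕ, 1 ≤ k → HasSum (fun i ↦ (α i : ℂ) * w i ^ k) 0) {k : ℕ} (hk : 1 ≤ k) :
    modelPsi m₁ m₂ κ₁ κ₂ (k * h) =
      2 * lam * (2 * ∑' i, α i - ∑' i, α i * ((w i ^ k)⁻¹).re) := by
  rw [modelPsi_lattice_eq_tsum hw₁ hw₂ htune k]
  congr 1
  have h2 : HasSum (fun i ↦ α i * 2) ((∑' i, α i) * 2) := hα.hasSum.mul_right 2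
  have h0 : HasSum (fun i ↦ α i * (w i ^ k).re) 0 := by
    have := Complex.hasSum_re (hW k hk)
    simpa [Complex.re_ofReal_mul] using this
  have h3 := (summable_alpha_mul_re_inv hα hα0 hw1 k).hasSum
  have h4 := (h2.sub h0).sub h3
  have e : (fun i ↦ α i * (2 - (w i ^ k).re - ((w i ^ k)⁻¹).re)) =
      fun i ↦ α i * 2 - α i * (w i ^ k).re - α i * ((w i ^ k)⁻¹).re := by
    funext i; ring
  rw [e, h4.tsum_eq]
  ring

/-- **UNIFORM POSITIVE LATTICE FLOOR**: `Ψ_Z(k h) ≥ 2λ Σ_i α_i` for every `k ≥ 1` (`λ ≥ 0`).  In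
particular `LAT(h)` holds for the model, with a floor, although no zero-free strip need exist. -/
theorem modelPsi_lattice_floor (hw₁ : ∀ i, Complex.exp (κ₁ i * h) = w i)
    (hw₂ : ∀ i, Complex.exp (κ₂ i * h) = conj (w i))
    (htune : ∀ i, (m₁ i : ℂ) / κ₁ i ^ 2 + (m₂ i : ℂ) / (conj (κ₂ i)) ^ 2 = -((lam * α i : ℝ) : ℂ))
    (hα : Summable α) (hα0 : ∀ i, 0 ≤ α i) (hw1 : ∀ i, 1 ≤ ‖w i‖) (hlam : 0 ≤ lam)
    (hW : ∀ k : ℕ, 1 ≤ k → HasSum (fun i ↦ (α i : ℂ) * w i ^ k) 0) {k : ℕ} (hk : 1 ≤ k) :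
    2 * lam * ∑' i, α i ≤ modelPsi m₁ m₂ κ₁ κ₂ (k * h) := by
  rw [modelPsi_lattice hw₁ hw₂ htune hα hα0 hw1 hW hk]
  have hB := tsum_alpha_mul_re_inv_abs_le hα hα0 hw1 k
  have hB' := (abs_le.1 hB).2
  have h2 : 0 ≤ 2 * lam := by positivity
  nlinarith

/-- **UNIFORM LATTICE CEILING**: `Ψ_Z(k h) ≤ 6λ Σ_i α_i` for every `k ≥ 1` (`λ ≥ 0`): the lattice values are
BOUNDED (while, off the lattice, the model's `Ψ_Z` is exponentially large of both signs). -/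
theorem modelPsi_lattice_ceiling (hw₁ : ∀ i, Complex.exp (κ₁ i * h) = w i)
    (hw₂ : ∀ i, Complex.exp (κ₂ i * h) = conj (w i))
    (htune : ∀ i, (m₁ i : ℂ) / κ₁ i ^ 2 + (m₂ i : ℂ) / (conj (κ₂ i)) ^ 2 = -((lam * α i : ℝ) : ℂ))
    (hα : Summable α) (hα0 : ∀ i, 0 ≤ α i) (hw1 : ∀ i, 1 ≤ ‖w i‖) (hlam : 0 ≤ lam)
    (hW : ∀ k : ℕ, 1 ≤ k → HasSum (fun i ↦ (α i : ℂ) * w i ^ k) 0) {k : ℕ} (hk : 1 ≤ k) :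
    modelPsi m₁ m₂ κ₁ κ₂ (k * h) ≤ 6 * lam * ∑' i, α i := by
  rw [modelPsi_lattice hw₁ hw₂ htune hα hα0 hw1 hW hk]
  have hB := tsum_alpha_mul_re_inv_abs_le hα hα0 hw1 k
  have hB' := (abs_le.1 hB).1
  have h2 : 0 ≤ 2 * lam := by positivity
  nlinarith

/-- `LAT(h)` for the model: `0 ≤ Ψ_Z(k h)` for every `k ∈ ℕ` (`λ ≥ 0`, `α ≥ 0`). -/
theorem modelPsi_latticePos (hw₁ : ∀ i, Complex.exp (κ₁ i * h) = w i)
    (hw₂ : ∀ i, Complex.exp (κ₂ i * h) = conj (w i))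
    (htune : ∀ i, (m₁ i : ℂ) / κ₁ i ^ 2 + (m₂ i : ℂ) / (conj (κ₂ i)) ^ 2 = -((lam * α i : ℝ) : ℂ))
    (hα : Summable α) (hα0 : ∀ i, 0 ≤ α i) (hw1 : ∀ i, 1 ≤ ‖w i‖) (hlam : 0 ≤ lam)
    (hW : ∀ k : ℕ, 1 ≤ k → HasSum (fun i ↦ (α i : ℂ) * w i ^ k) 0) (k : ℕ) :
    0 ≤ modelPsi m₁ m₂ κ₁ κ₂ (k * h) := by
  rcases Nat.eq_zero_or_pos k with rfl | hk
  · simp [modelPsi_zero]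
  · refine le_trans ?_ (modelPsi_lattice_floor hw₁ hw₂ htune hα hα0 hw1 hlam hW hk)
    have : 0 ≤ ∑' i, α i := tsum_nonneg hα0
    positivity


/-! ## 5. The model passes the lattice KERNEL test: `LPSD(h)` -/

/-- Summability bookkeeping for the negative definite pieces. -/
theorem summable_alpha_mul_negdef (hα : Summable α) (hα0 : ∀ i, 0 ≤ α i) (hw1 : ∀ i, 1 ≤ ‖w i‖)
    (k : ℕ) : Summable fun i ↦ α i * ((1 - ((0 : ℂ) ^ k).re) + (1 - ((w i)⁻¹ ^ k).re)) := by
  refine Summable.of_norm_bounded (hα.mul_right 4) fun i ↦ ?_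
  rw [Real.norm_eq_abs, abs_mul, abs_of_nonneg (hα0 i)]
  refine mul_le_mul_of_nonneg_left ?_ (hα0 i)
  have h0 : |((0 : ℂ) ^ k).re| ≤ 1 := by
    refine (Complex.abs_re_le_norm _).trans ?_
    rw [norm_pow, norm_zero]
    rcases Nat.eq_zero_or_pos k with rfl | hk
    · simp
    · rw [zero_pow hk.ne']; exact zero_le_one
  have h1 : |((w i)⁻¹ ^ k).re| ≤ 1 := by
    refine (Complex.abs_re_le_norm _).trans ?_
    rw [norm_pow, norm_inv]
    exact pow_le_one₀ (by positivity) (inv_le_one_of_one_le₀ (hw1 i))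
  have := abs_le.1 h0
  have := abs_le.1 h1
  rw [abs_le]
  constructor <;> linarith

/-- **NEGATIVE DEFINITE NORMAL FORM** of the lattice values (uses (W)): for every `k ∈ ℕ`,
`Ψ_Z(k h) = 2λ Σ_i α_i ((1 - Re 0^k) + (1 - Re (w_i^{-1})^k))` (`1 - Re 0^k = [k ≠ 0]`). -/
theorem modelPsi_lattice_negdef (hw₁ : ∀ i, Complex.exp (κ₁ i * h) = w i)
    (hw₂ : ∀ i, Complex.exp (κ₂ i * h) = conj (w i))
    (htune : ∀ i, (m₁ i : ℂ) / κ₁ i ^ 2 + (m₂ i : ℂ) / (conj (κ₂ i)) ^ 2 = -((lam * α i : ℝ) : ℂ))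
    (hα : Summable α) (hα0 : ∀ i, 0 ≤ α i) (hw1 : ∀ i, 1 ≤ ‖w i‖)
    (hW : ∀ k : ℕ, 1 ≤ k → HasSum (fun i ↦ (α i : ℂ) * w i ^ k) 0) (k : ℕ) :
    modelPsi m₁ m₂ κ₁ κ₂ (k * h) =
      2 * lam * ∑' i, α i * ((1 - ((0 : ℂ) ^ k).re) + (1 - ((w i)⁻¹ ^ k).re)) := by
  rw [modelPsi_lattice_eq_tsum hw₁ hw₂ htune k]
  congr 1
  rcases Nat.eq_zero_or_pos k with rfl | hk
  · norm_num
  · have h0 : HasSum (fun i ↦ α i * (w i ^ k).re) 0 := by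
      have := Complex.hasSum_re (hW k hk)
      simpa [Complex.re_ofReal_mul] using this
    have hR := (summable_alpha_mul_negdef hα hα0 hw1 k).hasSum
    have h := hR.sub h0
    rw [sub_zero] at h
    refine Eq.trans (tsum_congr fun i ↦ ?_) h.tsum_eq
    rw [zero_pow hk.ne', Complex.zero_re, inv_pow]
    ring

/-- **THE MODEL PASSES THE LATTICE KERNEL TEST (`LPSD(h)`).**  Under the Wolff identity (W) and the
tuning (`λ ≥ 0`, `α ≥ 0`, `|w_i| ≥ 1`), the Kreĭn–Suzuki kernel of the model,
`Ψ_Z(s) + Ψ_Z(t) - Ψ_Z(s - t)`, is non-negative definite on the lattice `{k h : k ∈ ℕ}` — the exact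
analogue of `IsPosSemidefKernelOn zetaScrewKernel (h ℕ)` (which RH implies for `ζ`, Suzuki Thm 1.2). -/
theorem modelPsi_latticePSD (hw₁ : ∀ i, Complex.exp (κ₁ i * h) = w i)
    (hw₂ : ∀ i, Complex.exp (κ₂ i * h) = conj (w i))
    (htune : ∀ i, (m₁ i : ℂ) / κ₁ i ^ 2 + (m₂ i : ℂ) / (conj (κ₂ i)) ^ 2 = -((lam * α i : ℝ) : ℂ))
    (hα : Summable α) (hα0 : ∀ i, 0 ≤ α i) (hw1 : ∀ i, 1 ≤ ‖w i‖) (hlam : 0 ≤ lam)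
    (hW : ∀ k : ℕ, 1 ≤ k → HasSum (fun i ↦ (α i : ℂ) * w i ^ k) 0)
    {N : ℕ} (t x : Fin N → ℝ) (ht : ∀ a, t a ∈ Set.range fun k : ℕ ↦ (k : ℝ) * h) :
    0 ≤ ∑ a, ∑ b, (modelPsi m₁ m₂ κ₁ κ₂ (t a) + modelPsi m₁ m₂ κ₁ κ₂ (t b) -
      modelPsi m₁ m₂ κ₁ κ₂ (t a - t b)) * (x a * x b) := by
  choose p hp using ht
  have hp' : ∀ a, (p a : ℝ) * h = t a := fun a ↦ hp a
  set φ : ι → ℕ → ℝ := fun i k ↦ α i * ((1 - ((0 : ℂ) ^ k).re) + (1 - ((w i)⁻¹ ^ k).re)) with hφ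
  have hfφ : ∀ k : ℕ, modelPsi m₁ m₂ κ₁ κ₂ (k * h) = 2 * lam * ∑' i, φ i k := fun k ↦
    modelPsi_lattice_negdef hw₁ hw₂ htune hα hα0 hw1 hW k
  have hφs : ∀ k, Summable fun i ↦ φ i k := fun k ↦ summable_alpha_mul_negdef hα hα0 hw1 k
  -- the three kernel entries are lattice values
  have hta : ∀ a, modelPsi m₁ m₂ κ₁ κ₂ (t a) = modelPsi m₁ m₂ κ₁ κ₂ ((p a : ℕ) * h) :=
    fun a ↦ by rw [hp' a]
  have htd : ∀ a b, modelPsi m₁ m₂ κ₁ κ₂ (t a - t b) =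
      modelPsi m₁ m₂ κ₁ κ₂ ((ndist (p a) (p b) : ℕ) * h) := by
    intro a b
    unfold ndist
    split_ifs with hle
    · rw [← hp' a, ← hp' b, Nat.cast_sub hle, sub_mul]
    · rw [← modelPsi_neg, ← hp' a, ← hp' b, Nat.cast_sub (by omega)]
      congr 1; ring
  simp_rw [hta, htd, hfφ]
  -- per entry: combine the three sums
  have hcomb : ∀ a b, (2 * lam * ∑' i, φ i (p a) + 2 * lam * ∑' i, φ i (p b) -
      2 * lam * ∑' i, φ i (ndist (p a) (p b))) * (x a * x b) =
      2 * lam * ∑' i, (φ i (p a) + φ i (p b) - φ i (ndist (p a) (p b))) * (x a * x b) := by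
    intro a b
    rw [tsum_mul_right, ((hφs (p a)).add (hφs (p b))).tsum_sub (hφs _),
      (hφs (p a)).tsum_add (hφs (p b))]
    ring
  simp_rw [hcomb]
  simp_rw [← Finset.mul_sum]
  refine mul_nonneg (by positivity) ?_
  -- interchange the finite sums with the series
  have hΦs : ∀ a b, Summable fun i ↦
      (φ i (p a) + φ i (p b) - φ i (ndist (p a) (p b))) * (x a * x b) :=
    fun a b ↦ (((hφs (p a)).add (hφs (p b))).sub (hφs _)).mul_right _
  rw [show (∑ a, ∑ b, ∑' i, (φ i (p a) + φ i (p b) - φ i (ndist (p a) (p b))) * (x a * x b)) =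
      ∑' i, ∑ a, ∑ b, (φ i (p a) + φ i (p b) - φ i (ndist (p a) (p b))) * (x a * x b) by
    rw [Summable.tsum_finsetSum (fun a _ ↦ summable_sum fun b _ ↦ hΦs a b)]
    refine Finset.sum_congr rfl fun a _ ↦ ?_
    rw [Summable.tsum_finsetSum (fun b _ ↦ hΦs a b)]]
  refine tsum_nonneg fun i ↦ ?_
  -- per atom pair: `α_i × (Form(g₀) + Form(g_{u_i}))`, both forms non-negative
  have hsplit : ∑ a, ∑ b, (φ i (p a) + φ i (p b) - φ i (ndist (p a) (p b))) * (x a * x b) =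
      α i * (∑ a, ∑ b, ((1 - ((0 : ℂ) ^ p a).re) + (1 - ((0 : ℂ) ^ p b).re) -
          (1 - ((0 : ℂ) ^ ndist (p a) (p b)).re)) * (x a * x b)) +
        α i * (∑ a, ∑ b, ((1 - ((w i)⁻¹ ^ p a).re) + (1 - ((w i)⁻¹ ^ p b).re) -
          (1 - ((w i)⁻¹ ^ ndist (p a) (p b)).re)) * (x a * x b)) := by
    rw [Finset.mul_sum, Finset.mul_sum, ← Finset.sum_add_distrib]
    refine Finset.sum_congr rfl fun a _ ↦ ?_
    rw [Finset.mul_sum, Finset.mul_sum, ← Finset.sum_add_distrib]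
    refine Finset.sum_congr rfl fun b _ ↦ ?_
    simp only [hφ]
    ring
  rw [hsplit]
  have hu0 : ‖(0 : ℂ)‖ ≤ 1 := by simp
  have hui : ‖(w i)⁻¹‖ ≤ 1 := by rw [norm_inv]; exact inv_le_one_of_one_le₀ (hw1 i)
  exact add_nonneg (mul_nonneg (hα0 i) (negdefForm_nonneg hu0 p x))
    (mul_nonneg (hα0 i) (negdefForm_nonneg hui p x))

end Model

end Summit.RiemannHypothesis.RiemannHypothesis.Theorems.Splittings.ScrewLatticeWolff

end
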